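import Mathlib
import HarnessLib
import Summits.HubbardSuperconductivity.HubbardSuperconductivity.Theorems.KLProgrammePerturbedFermiCurveTwoFrameRegime
import Summits.HubbardSuperconductivity.HubbardSuperconductivity.Theorems.KLProgrammePerturbedFermiCurveTowerOfSizes
import Summits.HubbardSuperconductivity.HubbardSuperconductivity.Theorems.KLProgrammePerturbedFermiCurveNumerics
import Summits.HubbardSuperconductivity.HubbardSuperconductivity.Theorems.KLProgrammePerturbedFermiCurveTwoFrameGradedArith

/-!
# Route `KLProgramme` — K3 engine child (stmt-HubbardSuperconductivity-19918, `stub_twoLeg_step`, clause (E3a-MS) `TwoLegSizesMST`):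
# the two-frame implicit-function tower in GRADED form, with numerals

Cell `gate-hubbard-kl`, seat hubbard-kl-k3c3-p3 (g3) «implicit-function / monotonicity route for μ(n)», part (P2) of the (L)+(F) recipe
(k3c3-p1 MS-DESIGN-NOTE §3, plan g12 ruling STATUS l.1769).  `…PerturbedFermiCurveTwoFrameRegime` bounds the radius-tower differences
`W_k = |u_{K′}^{(k)}(θ) − u_K^{(k)}(θ)|` of two `C²`-small frames at a common level by closed forms in the difference sizes `E₀ … E₄` and the
towers of both frames; those closed forms have ≈ 60 terms at order 4.  For the slot bookkeeping of (P4) only their GRADED content matters: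
if the frames have common sizes `A ≤ 1/20` (`C²`), `A₃ ≤ λ` (`C³`), `A₄ ≤ λ²` (`C⁴`) for a scale parameter `λ ≥ 1`, and the difference
`δ_{K′} − δ_K` has nested sizes `E_i ≤ e·λ^i` on the closed square (`i ≤ 4`), then — with the numerals of `…PerturbedFermiCurveNumerics` —

* §1 `abs_deriv_tower_frameRadius_sub_le_graded`:
  `W₀ ≤ 6.1·e`, `W₁ ≤ 1.88·10⁴·eλ`, `W₂ ≤ 1.75·10⁸·eλ²`, `W₃ ≤ 2.71·10¹²·eλ³`, `W₄ ≤ 5.88·10¹⁶·eλ⁴ + 3.46·10¹⁰·A₄`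
  (the last entry is the one non-linear term `2·16A₄·K1⁴/(Dt_min − 2A)`: the fourth derivative of a frame is bounded, not Lipschitz);
* §2 `norm_iteratedFDeriv_fermiPointLp_sub_le_graded`: the curve towers `γ_K = toLp ∘ klFermiPoint ν K`:
  `‖Dⁱγ_{K′}(θ) − Dⁱγ_K(θ)‖ ≤ 3.78·10⁴·eλ, 3.52·10⁸·eλ², 5.45·10¹²·eλ³, 1.19·10¹⁷·eλ⁴ + 6.92·10¹⁰·A₄` (`i = 1 … 4`), and
  `‖γ_{K′}(θ) − γ_K(θ)‖ ≤ 12.2·e`.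

In the application (slot `m` of (F)): `λ = 4^m`, `e ≍ ‖high part of piece m‖_∞`, `A₃, A₄` = the `C³, C⁴` sizes of the base frame.
The arithmetic is isolated in `…TwoFrameGradedArith` (`graded_aux_*`: pure real inequalities — `gcongr` onto the numerals, `ring` normal form,
`linarith` over the monomials `e·λ^p ≤ e·λ^k`).  Everything is PROVED; no definitions, no named facts. [cite: BenfattoGiulianiMastropietro2006, §2.4 Lemma 2.1 (2.40)]
-/

noncomputable section

namespace Summit.HubbardSuperconductivity.HubbardSuperconductivity.Theorems.PerturbedFermiCurve

set_option linter.dupNamespace false -- summit = problem name (single-conjunct summit), D-0017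
set_option maxSynthPendingDepth 3 -- nested operator-norm instances (third/fourth Fréchet derivatives)

open Real Set
open Literature.MathematicalPhysics.QuantumLattice Literature.MathematicalPhysics.QuantumLattice.BandSectorCounting
open Summit.HubbardSuperconductivity.HubbardSuperconductivity.Theorems.DispersionFlow
open Summit.HubbardSuperconductivity.HubbardSuperconductivity.Theorems.KLRegimeSplit

/-! ## §1 The radius towers of two frames, graded -/

section Graded

variable {K K' : TrigPolyC4v} {A : ℝ}
  (hA : ∀ p : Momentum, ∀ j ≤ 2, ‖iteratedFDeriv ℝ j (frameShift K) p‖ ≤ A)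
  (hA' : ∀ p : Momentum, ∀ j ≤ 2, ‖iteratedFDeriv ℝ j (frameShift K') p‖ ≤ A) (hA20 : A ≤ 1 / 20)
  (hd : klCurveD ≤ (bandBounds (show (-4 : ℝ) < -1.1 by norm_num) (show (-1.1 : ℝ) ≤ -0.1 by norm_num)
    (show (-0.1 : ℝ) < 0 by norm_num)).Dtmin - 2 * A)
  {ν : ℝ} (hlo : (-1.1 : ℝ) ≤ ν - A) (hhi : ν + A ≤ -0.1)
  {A₃ A₄ e l : ℝ} (he : 0 ≤ e) (hl : 1 ≤ l)
  (hA₃ : ∀ p : Momentum, ‖iteratedFDeriv ℝ 3 (frameShift K) p‖ ≤ A₃)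
  (hA₃' : ∀ p : Momentum, ‖iteratedFDeriv ℝ 3 (frameShift K') p‖ ≤ A₃) (hA₃l : A₃ ≤ l)
  (hA₄ : ∀ p : Momentum, ‖iteratedFDeriv ℝ 4 (frameShift K) p‖ ≤ A₄)
  (hA₄' : ∀ p : Momentum, ‖iteratedFDeriv ℝ 4 (frameShift K') p‖ ≤ A₄) (hA₄l : A₄ ≤ l ^ 2)
  (hE₀ : ∀ k : Fin 2 → ℝ, (∀ i, |k i| ≤ π) → |(fun p : Fin 2 → ℝ => -K'.eval p) k - (fun p : Fin 2 → ℝ => -K.eval p) k| ≤ e)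
  (hE₁ : ∀ k : Fin 2 → ℝ, (∀ i, |k i| ≤ π) →
    ‖fderiv ℝ (fun p : Fin 2 → ℝ => -K'.eval p) k - fderiv ℝ (fun p : Fin 2 → ℝ => -K.eval p) k‖ ≤ e * l)
  (hE₂ : ∀ k : Fin 2 → ℝ, (∀ i, |k i| ≤ π) →
    ‖fderiv ℝ (fderiv ℝ (fun p : Fin 2 → ℝ => -K'.eval p)) k - fderiv ℝ (fderiv ℝ (fun p : Fin 2 → ℝ => -K.eval p)) k‖ ≤ e * l ^ 2)
  (hE₃ : ∀ k : Fin 2 → ℝ, (∀ i, |k i| ≤ π) →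
    ‖fderiv ℝ (fderiv ℝ (fderiv ℝ (fun p : Fin 2 → ℝ => -K'.eval p))) k -
      fderiv ℝ (fderiv ℝ (fderiv ℝ (fun p : Fin 2 → ℝ => -K.eval p))) k‖ ≤ e * l ^ 3)
  (hE₄ : ∀ k : Fin 2 → ℝ, (∀ i, |k i| ≤ π) →
    ‖fderiv ℝ (fderiv ℝ (fderiv ℝ (fderiv ℝ (fun p : Fin 2 → ℝ => -K'.eval p)))) k -
      fderiv ℝ (fderiv ℝ (fderiv ℝ (fderiv ℝ (fun p : Fin 2 → ℝ => -K.eval p)))) k‖ ≤ e * l ^ 4)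
include hA hA' hA20 hd hlo hhi he hl hA₃ hA₃' hA₃l hA₄ hA₄' hA₄l hE₀ hE₁ hE₂ hE₃ hE₄

/-- **The radius towers of two `C²`-small frames at a common level, GRADED**: if both frames have `C²` size `A ≤ 1/20` (window margins,
`klCurveD ≤ Dt_min − 2A`), `C³` size `A₃ ≤ λ`, `C⁴` size `A₄ ≤ λ²` (`λ ≥ 1`), and `δ_{K′} − δ_K` has nested sizes `E_i ≤ e·λ^i` on the
closed square, then at every angle
`|u_{K′} − u_K| ≤ 6.1e`, `|u_{K′}′ − u_K′| ≤ 1.88·10⁴·eλ`, `|u″…| ≤ 1.75·10⁸·eλ²`, `|u‴…| ≤ 2.71·10¹²·eλ³`, `|u⁗…| ≤ 5.88·10¹⁶·eλ⁴ + 3.46·10¹⁰·A₄`.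
[cite: BenfattoGiulianiMastropietro2006, §2.4 Lemma 2.1 (2.40)] -/
theorem abs_deriv_tower_frameRadius_sub_le_graded (θ : ℝ) :
    |perturbedFermiRadius (fun p : Fin 2 → ℝ => -K'.eval p) ν θ - perturbedFermiRadius (fun p : Fin 2 → ℝ => -K.eval p) ν θ| ≤
      6.1 * e ∧
    |deriv (perturbedFermiRadius (fun p : Fin 2 → ℝ => -K'.eval p) ν) θ -
        deriv (perturbedFermiRadius (fun p : Fin 2 → ℝ => -K.eval p) ν) θ| ≤ 18800 * e * l ∧
    |deriv (deriv (perturbedFermiRadius (fun p : Fin 2 → ℝ => -K'.eval p) ν)) θ -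
        deriv (deriv (perturbedFermiRadius (fun p : Fin 2 → ℝ => -K.eval p) ν)) θ| ≤ 175000000 * e * l ^ 2 ∧
    |deriv (deriv (deriv (perturbedFermiRadius (fun p : Fin 2 → ℝ => -K'.eval p) ν))) θ -
        deriv (deriv (deriv (perturbedFermiRadius (fun p : Fin 2 → ℝ => -K.eval p) ν))) θ| ≤ 2710000000000 * e * l ^ 3 ∧
    |deriv (deriv (deriv (deriv (perturbedFermiRadius (fun p : Fin 2 → ℝ => -K'.eval p) ν)))) θ -
        deriv (deriv (deriv (deriv (perturbedFermiRadius (fun p : Fin 2 → ℝ => -K.eval p) ν)))) θ| ≤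
      58800000000000000 * e * l ^ 4 + 34600000000 * A₄ := by
  set B := bandBounds (show (-4 : ℝ) < -1.1 by norm_num) (show (-1.1 : ℝ) ≤ -0.1 by norm_num) (show (-0.1 : ℝ) < 0 by norm_num)
    with hBdef
  have hDpos := klCurveD_pos
  have hADt : 2 * A < B.Dtmin := by linarith
  have hρ : (33 : ℝ) / 200 ≤ B.Dtmin - 2 * A := klCurveD_ge.trans hd
  have hρ0 : 0 < B.Dtmin - 2 * A := by linarith
  have hA0 : 0 ≤ A := (norm_nonneg _).trans (hA 0 0 (by norm_num))
  have hA₃0 : 0 ≤ A₃ := (norm_nonneg _).trans (hA₃ 0)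
  have hA₄0 : 0 ≤ A₄ := (norm_nonneg _).trans (hA₄ 0)
  have hs0 : 0 ≤ π * Real.sqrt 2 := pi_mul_sqrt_two_nonneg
  have hs : π * Real.sqrt 2 ≤ 4.45 := pi_mul_sqrt_two_le
  have hl0 : 0 ≤ l := zero_le_one.trans hl
  obtain ⟨-, hR₁, hR₂, hR₃, hR₄⟩ := frameRadius_tower_of_sizes hA hA20 hd hlo hhi hA₃ hA₄ θ
  obtain ⟨-, hR₁', hR₂', hR₃', -⟩ := frameRadius_tower_of_sizes hA' hA20 hd hlo hhi hA₃' hA₄' θ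
  have hT3 : klCurveT3 A₃ ≤ 3200000000 + 76000000 * l := (klCurveT3_le hA₃0).trans (by nlinarith)
  have hT30 : 0 ≤ klCurveT3 A₃ := klCurveT3_nonneg hA₃0
  have hT4 : klCurveT4 A₃ A₄ ≤ 49000000000000 + 2300000000000 * l + 18000000000 * l ^ 2 :=
    (klCurveT4_le hA₃0 hA₄0).trans (by nlinarith)
  have he1 : 0 ≤ e * l := by positivity
  have he2 : 0 ≤ e * l ^ 2 := by positivity
  -- order 0
  have gW₀ : |perturbedFermiRadius (fun p : Fin 2 → ℝ => -K'.eval p) ν θ -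
      perturbedFermiRadius (fun p : Fin 2 → ℝ => -K.eval p) ν θ| ≤ 6.1 * e := by
    refine (abs_frameRadius_sub_le B hA hA' hADt hlo hhi hE₀ θ).trans ?_
    rw [div_le_iff₀ hρ0]; nlinarith
  -- order 1
  have gW₁ : |deriv (perturbedFermiRadius (fun p : Fin 2 → ℝ => -K'.eval p) ν) θ -
      deriv (perturbedFermiRadius (fun p : Fin 2 → ℝ => -K.eval p) ν) θ| ≤ 18800 * e * l :=
    (abs_deriv_frameRadius_sub_le B hA hA' hADt hlo hhi hE₀ hE₁ θ).trans
      (graded_aux_one hρ hA0 hA20 hs0 hs he hl he le_rfl he1 le_rfl)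
  have gW₁0 : 0 ≤ 18800 * e * l := by positivity
  -- order 2
  obtain ⟨h2, -, -⟩ := abs_deriv_tower_frameRadius_sub_le B hA hA' hADt hlo hhi hE₀ hA₃ hA₄ hE₁ hE₂ hE₃ hE₄ hR₁ hR₁' hR₂ hR₂' hR₃
    hR₃' hR₄ gW₁ le_rfl le_rfl
  have gW₂ : |deriv (deriv (perturbedFermiRadius (fun p : Fin 2 → ℝ => -K'.eval p) ν)) θ -
      deriv (deriv (perturbedFermiRadius (fun p : Fin 2 → ℝ => -K.eval p) ν)) θ| ≤ 175000000 * e * l ^ 2 :=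
    h2.trans (graded_aux_two hρ hA0 hA20 hs0 hs klCurveR1_nonneg klCurveR1_le klCurveR2_le he hl hA₃l he le_rfl he1 le_rfl
      he2 le_rfl gW₁0 le_rfl)
  have gW₂0 : 0 ≤ 175000000 * e * l ^ 2 := by positivity
  -- order 3
  obtain ⟨-, h3, -⟩ := abs_deriv_tower_frameRadius_sub_le B hA hA' hADt hlo hhi hE₀ hA₃ hA₄ hE₁ hE₂ hE₃ hE₄ hR₁ hR₁' hR₂ hR₂' hR₃
    hR₃' hR₄ gW₁ gW₂ le_rfl
  have gW₃ : |deriv (deriv (deriv (perturbedFermiRadius (fun p : Fin 2 → ℝ => -K'.eval p) ν))) θ -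
      deriv (deriv (deriv (perturbedFermiRadius (fun p : Fin 2 → ℝ => -K.eval p) ν))) θ| ≤ 2710000000000 * e * l ^ 3 :=
    h3.trans (graded_aux_three hρ hA0 hA20 hs0 hs klCurveR1_nonneg klCurveR1_le klCurveR2_nonneg klCurveR2_le hT3 he hl hA₃l hA₄l
      he le_rfl he1 le_rfl le_rfl le_rfl gW₁0 le_rfl gW₂0 le_rfl)
  have gW₃0 : 0 ≤ 2710000000000 * e * l ^ 3 := by positivity
  -- order 4
  obtain ⟨-, -, h4⟩ := abs_deriv_tower_frameRadius_sub_le B hA hA' hADt hlo hhi hE₀ hA₃ hA₄ hE₁ hE₂ hE₃ hE₄ hR₁ hR₁' hR₂ hR₂' hR₃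
    hR₃' hR₄ gW₁ gW₂ gW₃
  have gW₄ := h4.trans (graded_aux_four hρ hA0 hA20 hs0 hs klCurveR1_nonneg klCurveR1_le klCurveR2_nonneg klCurveR2_le hT30 hT3
    hT4 he hl hA₃l hA₄0 hA₄l he le_rfl he1 le_rfl le_rfl le_rfl le_rfl gW₁0 le_rfl gW₂0 le_rfl gW₃0 le_rfl)
  exact ⟨gW₀, gW₁, gW₂, gW₃, gW₄⟩

/-! ## §2 The curve towers of two frames, graded -/

/-- **The curve towers of two frames, GRADED** (`γ_K θ = toLp 2 (klFermiPoint ν K θ)`): under the hypotheses of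
`abs_deriv_tower_frameRadius_sub_le_graded`, at every angle
`‖γ_{K′} − γ_K‖ ≤ 12.2·e`, `‖D¹γ_{K′} − D¹γ_K‖ ≤ 3.78·10⁴·eλ`, `‖D²…‖ ≤ 3.52·10⁸·eλ²`, `‖D³…‖ ≤ 5.45·10¹²·eλ³`,
`‖D⁴…‖ ≤ 1.19·10¹⁷·eλ⁴ + 6.92·10¹⁰·A₄`. [folklore] -/
theorem norm_iteratedFDeriv_fermiPointLp_sub_le_graded (θ : ℝ) :
    ‖(WithLp.toLp 2 (klFermiPoint ν K' θ) : Momentum) - WithLp.toLp 2 (klFermiPoint ν K θ)‖ ≤ 12.2 * e ∧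
    ‖iteratedFDeriv ℝ 1 (fun θ : ℝ => (WithLp.toLp 2 (klFermiPoint ν K' θ) : Momentum)) θ -
        iteratedFDeriv ℝ 1 (fun θ : ℝ => (WithLp.toLp 2 (klFermiPoint ν K θ) : Momentum)) θ‖ ≤ 37800 * e * l ∧
    ‖iteratedFDeriv ℝ 2 (fun θ : ℝ => (WithLp.toLp 2 (klFermiPoint ν K' θ) : Momentum)) θ -
        iteratedFDeriv ℝ 2 (fun θ : ℝ => (WithLp.toLp 2 (klFermiPoint ν K θ) : Momentum)) θ‖ ≤ 352000000 * e * l ^ 2 ∧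
    ‖iteratedFDeriv ℝ 3 (fun θ : ℝ => (WithLp.toLp 2 (klFermiPoint ν K' θ) : Momentum)) θ -
        iteratedFDeriv ℝ 3 (fun θ : ℝ => (WithLp.toLp 2 (klFermiPoint ν K θ) : Momentum)) θ‖ ≤ 5450000000000 * e * l ^ 3 ∧
    ‖iteratedFDeriv ℝ 4 (fun θ : ℝ => (WithLp.toLp 2 (klFermiPoint ν K' θ) : Momentum)) θ -
        iteratedFDeriv ℝ 4 (fun θ : ℝ => (WithLp.toLp 2 (klFermiPoint ν K θ) : Momentum)) θ‖ ≤
      119000000000000000 * e * l ^ 4 + 69200000000 * A₄ := by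
  set B := bandBounds (show (-4 : ℝ) < -1.1 by norm_num) (show (-1.1 : ℝ) ≤ -0.1 by norm_num) (show (-0.1 : ℝ) < 0 by norm_num)
    with hBdef
  have hDpos := klCurveD_pos
  have hADt : 2 * A < B.Dtmin := by linarith
  have hA₄0 : 0 ≤ A₄ := (norm_nonneg _).trans (hA₄ 0)
  obtain ⟨gW₀, gW₁, gW₂, gW₃, gW₄⟩ := abs_deriv_tower_frameRadius_sub_le_graded hA hA' hA20 hd hlo hhi he hl hA₃ hA₃' hA₃l hA₄ hA₄'
    hA₄l hE₀ hE₁ hE₂ hE₃ hE₄ θ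
  obtain ⟨d1, d2, d3, d4⟩ := norm_iteratedFDeriv_fermiPointLp_sub_le_four_orders B hA hA' hADt hlo hhi gW₀ gW₁ gW₂ gW₃ gW₄
  have h01 : e ≤ e * l := by nlinarith
  have h02 : e ≤ e * l ^ 2 := by simpa using graded_mono he hl (show 0 ≤ 2 by norm_num)
  have h12 : e * l ≤ e * l ^ 2 := by simpa using graded_mono he hl (show 1 ≤ 2 by norm_num)
  have h03 : e ≤ e * l ^ 3 := by simpa using graded_mono he hl (show 0 ≤ 3 by norm_num)
  have h13 : e * l ≤ e * l ^ 3 := by simpa using graded_mono he hl (show 1 ≤ 3 by norm_num)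
  have h23 : e * l ^ 2 ≤ e * l ^ 3 := graded_mono he hl (show 2 ≤ 3 by norm_num)
  have h04 : e ≤ e * l ^ 4 := by simpa using graded_mono he hl (show 0 ≤ 4 by norm_num)
  have h14 : e * l ≤ e * l ^ 4 := by simpa using graded_mono he hl (show 1 ≤ 4 by norm_num)
  have h24 : e * l ^ 2 ≤ e * l ^ 4 := graded_mono he hl (show 2 ≤ 4 by norm_num)
  have h34 : e * l ^ 3 ≤ e * l ^ 4 := graded_mono he hl (show 3 ≤ 4 by norm_num)
  have key : (WithLp.toLp 2 (klFermiPoint ν K' θ) : Momentum) - WithLp.toLp 2 (klFermiPoint ν K θ) =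
      WithLp.toLp 2 ((perturbedFermiRadius (fun p : Fin 2 → ℝ => -K'.eval p) ν θ -
        perturbedFermiRadius (fun p : Fin 2 → ℝ => -K.eval p) ν θ) • dir θ) := by
    rw [← WithLp.toLp_sub, sub_smul]; rfl
  have d0 : ‖(WithLp.toLp 2 (klFermiPoint ν K' θ) : Momentum) - WithLp.toLp 2 (klFermiPoint ν K θ)‖ ≤ 12.2 * e := by
    rw [key]
    refine (norm_toLp_two_le _).trans ?_
    rw [norm_smul, Real.norm_eq_abs]
    have h1 := norm_dir_le_one θ
    have := mul_le_mul gW₀ h1 (norm_nonneg _) (by positivity)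
    linarith
  exact ⟨d0, d1.trans (by linarith), d2.trans (by linarith), d3.trans (by linarith), d4.trans (by linarith)⟩

end Graded

end Summit.HubbardSuperconductivity.HubbardSuperconductivity.Theorems.PerturbedFermiCurve

end
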